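import Literature.MathematicalPhysics.QuantumLattice.HubbardSectorEnclosureCertificate
import Literature.Analysis.InnerProduct.CholeskyResidualEigenvalueBounds
import HarnessLib

/-!
# Verified-Cholesky sector certificates for Hubbard ground-state energies

Topic `MathematicalPhysics/QuantumLattice` (family `hubbard`); a thin companion of
`HubbardSectorEnclosureCertificate.lean` (Gram–Gershgorin sector certificates with an EXPLICIT
Hermitian remainder and a row-sum bound). A "verified floating-point Cholesky" certificate
(S. M. Rump, *Verification of positive definiteness*, BIT 46 (2006) 433–452, Thm. 2.3
[cite: Rump2006, Thm 2.3]) delivers less: for the sector block `B = H.toBlock (sector a b) (sector a b)`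
of `H = hamiltonian G t U`, a shift `s` and a computed factor `R` such that the residual
`B − s·1 − Rᴴ R` is only DOMINATED entrywise, `‖(B − s·1 − Rᴴ R) i j‖ ≤ γ Σ_l ‖R l i‖ ‖R l j‖`
(`γ = γ_{n+1}`-type rounding constant; this domination is the floating-point theorem and is taken as the
hypothesis `hdom` — it is not formalised). From it,
`Literature.Analysis.InnerProduct.posSemidef_sub_of_shifted_residual_dominated` gives
`B − (s − γ‖R‖_F²)·1 ⪰ 0`, and the sector theorems of the companion file turn that into bounds on the
tree's `groundEnergyAt G t U N`:

* `groundEnergyAt_two_mul_ge_of_central_cholesky_certificate` — even `N = 2n`, the central sector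
  `(n, n)` alone: `s − γ ‖R‖_F² ≤ groundEnergyAt G t U (2n)`;
* `groundEnergyAt_ge_of_sector_cholesky_certificates` — any `N ≤ 2|Λ|`, one certificate per sector
  `(a, b)` with `a + b = N`, common conclusion `c ≤ groundEnergyAt G t U N`.

For bounds on HIGHER sector eigenvalues (deflation `λ_{k+1} ≥ σ`, Rayleigh–Ritz `λ_j ≤ μ_j`, cluster
counts) use `Matrix.IsHermitian.le_eigenvalues₀_of_deflation_posSemidef`,
`Matrix.IsHermitian.eigenvalues₀_le_of_ritz_posSemidef` and `card_filter_le_eq_of_antitone` of the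
imported file on the Hermitian block `(LiebThm1.hamiltonian_isHermitian G t U).submatrix _`.
No definitions, no named facts.
-/

noncomputable section

open Matrix Finset
open scoped ComplexOrder BigOperators

namespace Literature.MathematicalPhysics.QuantumLattice

open HubbardWave0 Literature.Analysis.InnerProduct

variable {Λ : Type*} [LinearOrder Λ] [Fintype Λ] (G : SimpleGraph Λ) [DecidableRel G.Adj]

/-- **Central-sector verified-Cholesky certificate** (`N = 2n`, `n ≤ |Λ|`): if the residual of the
shifted central block against a Gram matrix is dominated entrywise,
`‖(B_{nn} − s·1 − Rᴴ R) i j‖ ≤ γ Σ_l ‖R l i‖ ‖R l j‖` (`γ ≥ 0`), then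
`s − γ ‖R‖_F² ≤ groundEnergyAt G t U (2n)`. [cite: Rump2006, Thm 2.3] -/
theorem groundEnergyAt_two_mul_ge_of_central_cholesky_certificate (t U : ℝ) {n : ℕ}
    (hn : n ≤ Fintype.card Λ) {s γ : ℝ} (hγ : 0 ≤ γ) {k : Type*} [Fintype k]
    (R : Matrix k {x : Finset (Orb Λ) // Hubbard.sectorPred n n x} ℂ)
    (hdom : ∀ i j, ‖((hamiltonian G t U).toBlock (Hubbard.sectorPred n n) (Hubbard.sectorPred n n) -
        (s : ℂ) • (1 : Matrix {x : Finset (Orb Λ) // Hubbard.sectorPred n n x}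
          {x : Finset (Orb Λ) // Hubbard.sectorPred n n x} ℂ) - Rᴴ * R) i j‖ ≤
        γ * ∑ l, ‖R l i‖ * ‖R l j‖) :
    s - γ * ∑ l, ∑ j, ‖R l j‖ ^ 2 ≤ groundEnergyAt G t U (2 * n) :=
  groundEnergyAt_two_mul_ge_of_centralBlock_posSemidef G t U hn
    (posSemidef_sub_of_shifted_residual_dominated
      ((LiebThm1.hamiltonian_isHermitian G t U).submatrix _) R hγ hdom)

/-- **All-sector verified-Cholesky certificates** (`N ≤ 2|Λ|`): if every sector block `B_{ab}`
(`a, b ≤ |Λ|`, `a + b = N`) carries data `s, γ ≥ 0, R` with the dominated residual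
`‖(B_{ab} − s·1 − Rᴴ R) i j‖ ≤ γ Σ_l ‖R l i‖ ‖R l j‖` and `c ≤ s − γ ‖R‖_F²`, then
`c ≤ groundEnergyAt G t U N`. [cite: Rump2006, Thm 2.3] -/
theorem groundEnergyAt_ge_of_sector_cholesky_certificates (t U : ℝ) {N : ℕ}
    (hN : N ≤ 2 * Fintype.card Λ) {c : ℝ}
    (h : ∀ a b : ℕ, a ≤ Fintype.card Λ → b ≤ Fintype.card Λ → a + b = N →
      ∃ (s γ : ℝ) (k : ℕ) (R : Matrix (Fin k) {x : Finset (Orb Λ) // Hubbard.sectorPred a b x} ℂ),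
        0 ≤ γ ∧
        (∀ i j, ‖((hamiltonian G t U).toBlock (Hubbard.sectorPred a b) (Hubbard.sectorPred a b) -
            (s : ℂ) • (1 : Matrix {x : Finset (Orb Λ) // Hubbard.sectorPred a b x}
              {x : Finset (Orb Λ) // Hubbard.sectorPred a b x} ℂ) - Rᴴ * R) i j‖ ≤
            γ * ∑ l, ‖R l i‖ * ‖R l j‖) ∧
        c ≤ s - γ * ∑ l, ∑ j, ‖R l j‖ ^ 2) :
    c ≤ groundEnergyAt G t U N := by
  refine groundEnergyAt_ge_of_forall_sectorBlock_posSemidef G t U hN fun a b ha hb hab => ?_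
  obtain ⟨s, γ, k, R, hγ, hdom, hc⟩ := h a b ha hb hab
  have hpsd := posSemidef_sub_of_shifted_residual_dominated
    ((LiebThm1.hamiltonian_isHermitian G t U).submatrix _) R hγ hdom
  -- weaken the constant from `s − γ‖R‖_F²` to `c`
  have hcoe : ((hamiltonian G t U).toBlock (Hubbard.sectorPred a b) (Hubbard.sectorPred a b) -
      (c : ℂ) • (1 : Matrix _ _ ℂ)) =
      ((hamiltonian G t U).toBlock (Hubbard.sectorPred a b) (Hubbard.sectorPred a b) -
        ((s - γ * ∑ l, ∑ j, ‖R l j‖ ^ 2 : ℝ) : ℂ) • (1 : Matrix _ _ ℂ)) +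
      (((s - γ * ∑ l, ∑ j, ‖R l j‖ ^ 2) - c : ℝ) : ℂ) • (1 : Matrix _ _ ℂ) := by
    rw [Complex.ofReal_sub _ c, sub_smul]
    abel
  rw [hcoe]
  exact hpsd.add (Matrix.PosSemidef.one.smul (Complex.zero_le_real.2 (sub_nonneg.2 hc)))

end Literature.MathematicalPhysics.QuantumLattice

end
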